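import Literature.Geometry.Riemannian.RicciFlowScalarMaximumPrinciple
import Literature.Geometry.Riemannian.RicciFlowScalarCurvatureEvolution
import Literature.Geometry.Riemannian.RicciFlowSingularTimeHolds
import Literature.Geometry.Riemannian.RicciFlowSpatialRicciBounds
import Literature.Geometry.Riemannian.RicciFlowShortTimeProofs
import Literature.Geometry.Riemannian.RicciFlowMaximal
import Literature.Geometry.Riemannian.CurvatureNormSq
import Literature.Geometry.Riemannian.ChangGurskyYangRegularity
import HarnessLib

/-!
# Type-I bounds for a pinched maximal Ricci flow on a closed 4-manifold
(helpers of stub `stub_roundnessRate` of line `margerin-cone-hamilton-rails`, crux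
`EntropyRung.ChangGurskyYang`, item stmt-SmoothPoincare4-10834)

Step 4.B3 of STUB 4 (`stub_pinchedFlowConvergence` = Hamilton 1986, §5.2) of the line, FIRST HALF:
Hamilton 1982, §16 in unnormalised clothes. Along a maximal Ricci flow `(g, cov)` on `[0, T)` on a
closed 4-manifold with the invariant pinching `m ≤ R`, `|W|² + 2|E|² ≤ K R^{2−τ}` and with
`R_max/R_min → 1` (the ratio hypothesis), at all late times `1 ≤ (T−t)R ≤ 3` and
`K R^{−τ} ≤ 1/20`; moreover `R_min(t)(T−t) ≤ 2` and, whenever `2|Ric|² ≤ aR²` on `[t, T)`,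
`R_max(t) ≥ 1/(a(T−t))` (`helper_roundnessTypeOne`). Proof (fact-free; every analytic input is a
theorem of the tree): `exists_mul_scalarCurvatureWith_le` (`R_min(t)(T−t) ≤ n/2`: restart the flow at
`t`, `IsRicciFlow.comp_add_const`, and apply Topping's Cor. 3.2.4 `IsRicciFlow.singularTime_le`);
`exists_le_mul_scalarCurvatureWith` (`R_max(t₁) ≥ 1/(a(T−t₁))` if `2|Ric|² ≤ aR²` on `[t₁, T)` and
`R` is unbounded there: the weak maximum principle `weakMaximumPrinciple` for
`∂ₜR = ΔR + 2|Ric|² ≤ ΔR + aR²`, `IsRicciFlow.hasDerivWithinAt_scalarCurvatureWith`, with the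
comparison solution `φ(s) = b/(1 − abs)` of `φ' = aφ²`); `roundness_dictionary` (the pinching read
through the flow's Levi-Civita witness); `roundness_scalarCurvature_unbounded` (`R_max(t) → ∞`:
curvature blow-up `ricciFlow_curvature_blowup_of_shortTime ricciFlow_shortTime_existence_holds` and
`|Rm|² = |W|² + 2|E|² + R²/6 ≤ (Km^{−τ} + 1/6)R²`); `helper_roundnessTypeOne` (`θ = 9/10`).

## References

* R. S. Hamilton, *Three-manifolds with positive Ricci curvature*, J. Differential Geom. 17
  (1982) 255–306, §14 Thm. 14.1, §16 Lemmas 16.1–16.5. [Hamilton1982]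
* P. Topping, *Lectures on the Ricci flow*, LMS Lecture Note Series 325, CUP 2006, Thm. 3.1.1,
  Cor. 3.2.4, Thm. 5.3.1. [Topping2006]
-/


noncomputable section

-- every `Summit.SmoothPoincare4.SmoothPoincare4.…` name repeats the summit = sub-problem segment (D-0017 layout)
set_option linter.dupNamespace false

open Set Function Filter
open scoped Manifold ContDiff Topology

namespace Summit.SmoothPoincare4.SmoothPoincare4.Theorems.MargerinRails

open Literature.Geometry.Riemannian
open Literature.Geometry.Lorentzian Literature.Geometry.Lorentzian.PseudoRiemannianMetric

/-- **The comparison ODE `φ' = aφ²`**: `φ(s) = b/(1 − abs)` solves it away from the pole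
(Topping 2006, proof of Thm. 3.2.1, with `2/n` replaced by `a`). [cite: Topping2006, Thm. 3.2.1 (proof)] -/
theorem hasDerivAt_roundnessComparison (a b t : ℝ) (ht : 1 - a * b * t ≠ 0) :
    HasDerivAt (fun s : ℝ ↦ b / (1 - a * b * s)) (a * (b / (1 - a * b * t)) ^ 2) t := by
  have hden : HasDerivAt (fun s : ℝ ↦ 1 - a * b * s) (-(a * b)) t := by
    simpa using ((hasDerivAt_id t).const_mul (a * b)).const_sub 1
  refine ((hasDerivAt_const t b).div hden ht).congr_deriv ?_
  rw [div_pow]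
  field_simp
  ring

section General

variable {E : Type*} [NormedAddCommGroup E] [NormedSpace ℝ E] [FiniteDimensional ℝ E]
  [CompleteSpace E] {H : Type*} [TopologicalSpace H] {I : ModelWithCorners ℝ E H}
  {M : Type*} [TopologicalSpace M] [ChartedSpace H M] [IsManifold I ∞ M]
  {g : ℝ → PseudoRiemannianMetric I ∞ E (TangentSpace I : M → Type _)}
  {cov : ℝ → CovariantDerivative I E (TangentSpace I : M → Type _)} {T : ℝ}

/-- **Restarting a Ricci flow**: `s ↦ g(s + t₁)` is a Ricci flow on every `S ⊆ [0, T − t₁)`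
(`t₁ ≥ 0`; the equation is autonomous, `IsRicciFlow.comp_add_const`). [folklore] -/
theorem isRicciFlow_restart (hflow : IsRicciFlow g cov (Ico 0 T)) {t₁ : ℝ} (ht₁ : 0 ≤ t₁)
    {S : Set ℝ} (hS : S ⊆ Ico 0 (T - t₁)) :
    IsRicciFlow (fun s ↦ g (s + t₁)) (fun s ↦ cov (s + t₁)) S :=
  (hflow.comp_add_const t₁).mono fun s hs ↦ by
    have h := hS hs
    simp only [mem_preimage, mem_Ico] at h ⊢
    constructor <;> linarith [h.1, h.2]

variable [I.Boundaryless] [CompactSpace M]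

/-- **`R_min(t)·(T − t) ≤ n/2` along a Ricci flow on `[0, T)`** (Hamilton 1982, §16, Lemma 16.1,
unnormalised; Topping 2006, Cor. 3.2.4 restarted at `t`): the flow `s ↦ g(s + t)` lives on
`[0, T − t)` with `R ≥ R_min(t)` initially, so `T − t ≤ n/(2R_min(t))` (`IsRicciFlow.singularTime_le`).
[cite: Hamilton1982, §16, Lemma 16.1] [cite: Topping2006, Cor. 3.2.4 (p. 36)] -/
theorem exists_mul_scalarCurvatureWith_le [T2Space M] [SecondCountableTopology M] [Nonempty M]
    (hflow : IsRicciFlow g cov (Ico 0 T)) (hR : ∀ t ∈ Ico 0 T, (g t).IsRiemannian) {t : ℝ}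
    (ht : t ∈ Ico 0 T) :
    ∃ x : M, (T - t) * (g t).scalarCurvatureWith (cov t) x ≤ Module.finrank ℝ E / 2 := by
  have hcont : Continuous fun x ↦ (g t).scalarCurvatureWith (cov t) x :=
    ((hflow.isLeviCivita t ht).contMDiff_trace_ricci).continuous
  obtain ⟨x₀, -, hmin⟩ := isCompact_univ.exists_isMinOn univ_nonempty hcont.continuousOn
  refine ⟨x₀, ?_⟩
  set α := (g t).scalarCurvatureWith (cov t) x₀ with hα
  have hTt : 0 < T - t := sub_pos.2 ht.2
  rcases le_or_gt α 0 with hα0 | hα0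
  · exact (mul_nonpos_of_nonneg_of_nonpos hTt.le hα0).trans (by positivity)
  have hflow' : IsRicciFlow (fun s ↦ g (s + t)) (fun s ↦ cov (s + t)) (Ico 0 (T - t)) :=
    isRicciFlow_restart hflow ht.1 Subset.rfl
  have hR' : ∀ s ∈ Ico 0 (T - t), (g (s + t)).IsRiemannian := fun s hs ↦
    hR (s + t) ⟨by linarith [hs.1, ht.1], by linarith [hs.2]⟩
  have h0 : ∀ x : M, α ≤ (g (0 + t)).scalarCurvatureWith (cov (0 + t)) x := fun x ↦ by
    rw [zero_add]; exact (isMinOn_iff.mp hmin) x (mem_univ x)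
  have key := hflow'.singularTime_le hTt hR' hα0 h0
  rw [le_div_iff₀ (by positivity)] at key
  linarith

/-- **`R_max(t₁) ≥ 1/(a(T − t₁))` when `2|Ric|² ≤ aR²` on `[t₁, T)` and `R` is unbounded there**
(Hamilton 1982, §16, Lemma 16.2, unnormalised). Otherwise `b = max(R_max(t₁), 0)` has
`ab(T − t₁) < 1`, and for `t ∈ (t₁, T)` the weak maximum principle (Topping 2006, Thm. 3.1.1) on
`[0, t − t₁]` for the restarted flow, `∂ₜR = ΔR + 2|Ric|² ≤ ΔR + aR²`, `φ(s) = b/(1 − abs)`, gives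
`R(·, t) ≤ φ(t − t₁) ≤ b/(1 − ab(T − t₁))`: `R` would be bounded on `[t₁, T)`.
[cite: Hamilton1982, §16, Lemma 16.2] [cite: Topping2006, Thm. 3.1.1 (p. 35)] -/
theorem exists_le_mul_scalarCurvatureWith [Nonempty M] (hflow : IsRicciFlow g cov (Ico 0 T))
    (hR : ∀ t ∈ Ico 0 T, (g t).IsRiemannian) {t₁ : ℝ} (ht₁ : t₁ ∈ Ico 0 T) {a : ℝ} (ha : 0 < a)
    (hRic : ∀ t ∈ Ico t₁ T, ∀ x : M,
      2 * (g t).normSq x ((cov t).ricci x) ≤ a * (g t).scalarCurvatureWith (cov t) x ^ 2)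
    (hunb : ∀ L : ℝ, ∃ t ∈ Ico t₁ T, ∃ x : M, L < (g t).scalarCurvatureWith (cov t) x) :
    ∃ x : M, 1 ≤ a * (T - t₁) * (g t₁).scalarCurvatureWith (cov t₁) x := by
  by_contra hcon
  push Not at hcon
  -- the maximum `b ≥ 0` of `R(·, t₁)` and `0`
  have hcont : Continuous fun x ↦ (g t₁).scalarCurvatureWith (cov t₁) x :=
    ((hflow.isLeviCivita t₁ ht₁).contMDiff_trace_ricci).continuous
  obtain ⟨x₀, -, hmx⟩ := isCompact_univ.exists_isMaxOn univ_nonempty hcont.continuousOn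
  set b := max ((g t₁).scalarCurvatureWith (cov t₁) x₀) 0 with hb
  have hb0 : 0 ≤ b := le_max_right _ _
  have hbR : ∀ x, (g t₁).scalarCurvatureWith (cov t₁) x ≤ b := fun x ↦
    ((isMaxOn_iff.mp hmx) x (mem_univ x)).trans (le_max_left _ _)
  have hTt : 0 < T - t₁ := sub_pos.2 ht₁.2
  have hb1 : a * (T - t₁) * b < 1 := by
    rcases le_total ((g t₁).scalarCurvatureWith (cov t₁) x₀) 0 with h | h
    · rw [hb, max_eq_right h, mul_zero]; exact one_pos
    · rw [hb, max_eq_left h]; exact hcon x₀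
  have hab : 0 ≤ a * b := mul_nonneg ha.le hb0
  -- the comparison function `φ(s) = b / (1 - a b s)` stays below `L₀` on `[0, T - t₁]`
  set L₀ := b / (1 - a * b * (T - t₁)) with hL₀
  have hden : ∀ s, s ≤ T - t₁ → 0 < 1 - a * b * s := fun s hs1 ↦ by
    nlinarith [mul_le_mul_of_nonneg_left hs1 hab]
  have hφle : ∀ s, s ≤ T - t₁ → b / (1 - a * b * s) ≤ L₀ := fun s hs1 ↦
    div_le_div_of_nonneg_left hb0 (hden _ le_rfl) (by nlinarith [mul_le_mul_of_nonneg_left hs1 hab])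
  -- hence `R ≤ max L₀ b` on `[t₁, T)`: contradiction
  obtain ⟨t, ht, x, hx⟩ := hunb (max L₀ b)
  refine absurd hx (not_lt.2 ?_)
  rcases ht.1.eq_or_lt with rfl | ht₁t
  · exact (hbR x).trans (le_max_right _ _)
  -- maximum principle on the window `[0, w]`, `w = t - t₁`, for the restarted flow
  set w := t - t₁ with hw
  have hw0 : 0 < w := sub_pos.2 ht₁t
  have hwT : w < T - t₁ := by rw [hw]; linarith [ht.2]
  have hflow' : IsRicciFlow (fun s ↦ g (s + t₁)) (fun s ↦ cov (s + t₁)) (Icc 0 w) :=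
    isRicciFlow_restart hflow ht₁.1 (Icc_subset_Ico_right hwT)
  have hmem : ∀ s ∈ Icc 0 w, s + t₁ ∈ Ico t₁ T := fun s hs ↦
    ⟨by linarith [hs.1], by linarith [hs.2]⟩
  have hR' : ∀ s ∈ Icc 0 w, (g (s + t₁)).IsRiemannian := fun s hs ↦
    hR _ ⟨by linarith [hs.1, ht₁.1], (hmem s hs).2⟩
  have hF : ContDiffOn ℝ 1 (uncurry fun (r : ℝ) (_ : ℝ) ↦ a * r ^ 2) (univ ×ˢ Icc 0 w) :=
    (contDiff_const.mul (contDiff_fst.pow 2)).contDiffOn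
  have hu := hflow'.contMDiffOn_scalarCurvatureWith
  have hineq : ∀ s ∈ Icc 0 w, ∀ y : M,
      derivWithin (fun r ↦ (fun s y ↦ (g (s + t₁)).scalarCurvatureWith (cov (s + t₁)) y) r y)
          (Icc 0 w) s ≤
        (g (s + t₁)).laplaceBeltrami
            ((fun s y ↦ (g (s + t₁)).scalarCurvatureWith (cov (s + t₁)) y) s) y
          + mvfderiv I ((fun s y ↦ (g (s + t₁)).scalarCurvatureWith (cov (s + t₁)) y) s) y
              ((fun (_ : ℝ) (y : M) ↦ (0 : TangentSpace I y)) s y)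
          + (fun (r : ℝ) (_ : ℝ) ↦ a * r ^ 2)
              ((fun s y ↦ (g (s + t₁)).scalarCurvatureWith (cov (s + t₁)) y) s y) s := by
    intro s hs y
    have hev := (hflow'.hasDerivWithinAt_scalarCurvatureWith hw0 hs y).derivWithin
      (uniqueDiffOn_Icc hw0 s hs)
    have hle := hRic (s + t₁) (hmem s hs) y
    simp only [map_zero, add_zero]
    rw [hev]
    linarith
  have hφ : ∀ s ∈ Icc 0 w, HasDerivWithinAt (fun r ↦ b / (1 - a * b * r))
      ((fun (r : ℝ) (_ : ℝ) ↦ a * r ^ 2) ((fun r ↦ b / (1 - a * b * r)) s) s) (Icc 0 w) s :=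
    fun s hs ↦ (hasDerivAt_roundnessComparison a b s
      (hden s (hs.2.trans hwT.le)).ne').hasDerivWithinAt
  have key := weakMaximumPrinciple (α := b) hw0 hR' (fun (_ : ℝ) (y : M) ↦ (0 : TangentSpace I y))
    hF hu hineq hφ (by simp) (fun y ↦ by simpa using hbR y) w ⟨hw0.le, le_rfl⟩ x
  have hts : w + t₁ = t := by rw [hw]; ring
  simp only [hts] at key
  exact key.trans ((hφle w hwT.le).trans (le_max_left _ _))

end General

section FourDim

variable {M : Type*} [TopologicalSpace M] [T2Space M] [SecondCountableTopology M]
  [ChartedSpace (EuclideanSpace ℝ (Fin 4)) M] [IsManifold (𝓡 4) ∞ M] [CompactSpace M]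
  {g : ℝ → PseudoRiemannianMetric (𝓡 4) ∞ (EuclideanSpace ℝ (Fin 4)) (TangentSpace (𝓡 4) : M → Type _)}
  {cov : ℝ → CovariantDerivative (𝓡 4) (EuclideanSpace ℝ (Fin 4)) (TangentSpace (𝓡 4) : M → Type _)}
  {T m K τ : ℝ}

omit [T2Space M] [SecondCountableTopology M] [CompactSpace M] in
/-- **The pinching dictionary along the flow.** With `cov t` a Levi-Civita connection of `g t`
(`IsLeviCivita.ricci_eq_ricci`, `curvature_eq_riemann`) and `|E|² = |Ric|² − R²/4`,
`|W|² = |Rm|² − 2|Ric|² + R²/3` (Besse 1987, 1.116–1.118; tree `tracelessRicciNormSq_eq_normSq`,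
`weylNormSq_eq_curvNormSqWith`), the invariant pinching reads: `m ≤ R`, `0 ≤ |E|²`, `0 ≤ |W|²`,
`|W|² + 2|E|² ≤ K R^{2−τ}` in the `cov t` quantities. [cite: Besse1987, (1.116)–1.118] -/
theorem roundness_dictionary (hflow : IsRicciFlow g cov (Ico 0 T))
    (hRiem : ∀ t ∈ Ico 0 T, (g t).IsRiemannian)
    (hpinch : ∀ t ∈ Ico 0 T, ∀ [(g t).HasLeviCivita] (x : M),
      m ≤ (g t).scalarCurvature x ∧
        (g t).weylNormSq x + 2 * (g t).tracelessRicciNormSq x ≤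
          K * (g t).scalarCurvature x ^ (2 - τ))
    {t : ℝ} (ht : t ∈ Ico 0 T) (x : M) :
    m ≤ (g t).scalarCurvatureWith (cov t) x ∧
    0 ≤ (g t).normSq x ((cov t).ricci x) - (g t).scalarCurvatureWith (cov t) x ^ 2 / 4 ∧
    0 ≤ (g t).curvNormSqWith (cov t) x - 2 * (g t).normSq x ((cov t).ricci x) +
        (g t).scalarCurvatureWith (cov t) x ^ 2 / 3 ∧
    ((g t).curvNormSqWith (cov t) x - 2 * (g t).normSq x ((cov t).ricci x) +
        (g t).scalarCurvatureWith (cov t) x ^ 2 / 3) +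
      2 * ((g t).normSq x ((cov t).ricci x) - (g t).scalarCurvatureWith (cov t) x ^ 2 / 4) ≤
      K * (g t).scalarCurvatureWith (cov t) x ^ (2 - τ) := by
  haveI := (g t).hasLeviCivita
  have h2 : (2 : ℕ∞ω) ≤ ∞ := WithTop.coe_le_coe.mpr le_top
  have hLC := hflow.isLeviCivita t ht
  have hric : (cov t).ricci x = (g t).ricci x := hLC.ricci_eq_ricci h2 x
  have hscal : (g t).scalarCurvatureWith (cov t) x = (g t).scalarCurvature x := by
    show (g t).trace x ((cov t).ricci x) = (g t).trace x ((g t).ricci x)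
    rw [hric]
  have hcurv : (g t).curvNormSqWith (cov t) x = (g t).curvNormSqWith (g t).leviCivita x :=
    (g t).curvNormSqWith_congr (hLC.curvature_eq_riemann h2 x)
  have hE := (g t).tracelessRicciNormSq_eq_normSq (hRiem t ht) finrank_euclideanSpace_fin x
  have hW := (g t).weylNormSq_eq_curvNormSqWith (hRiem t ht) finrank_euclideanSpace_fin x
  obtain ⟨hm, hp⟩ := hpinch t ht x
  have hEnn := (g t).tracelessRicciNormSq_nonneg x
  have hWnn := (g t).weylNormSq_nonneg x
  rw [hric, hscal, hcurv]
  refine ⟨hm, ?_, ?_, ?_⟩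
  · rw [← hE]; exact hEnn
  · rw [← hW]; exact hWnn
  · rw [← hE, ← hW]; exact hp

/-- **`R_max(t) → ∞` at the maximal time of a pinched flow** (Hamilton 1982, Thm. 14.1, in
Topping's form Thm. 5.3.1 = tree theorem `ricciFlow_curvature_blowup_of_shortTime
ricciFlow_shortTime_existence_holds`): for every level `L` there is `t₁` with `R(x, t) > L` at some
`x`, for all `t ∈ [t₁, T)` — failure of the frame bound `√(A L'²)` gives `|Rm|² > A L'²` somewhere
(`curvatureBoundedBy_of_curvNormSqWith_le`), and `|Rm|² ≤ K R^{2−τ} + R²/6 ≤ A R²`, `A = K m^{−τ} + 1/6`.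
[cite: Hamilton1982, §14, Thm. 14.1 (p. 296)] [cite: Topping2006, Thm. 5.3.1] -/
theorem roundness_scalarCurvature_unbounded (hmax : IsMaximalRicciFlow g cov T) (hm : 0 < m)
    (hK : 0 < K) (hτ0 : 0 < τ)
    (hpinch : ∀ t ∈ Ico 0 T, ∀ [(g t).HasLeviCivita] (x : M),
      m ≤ (g t).scalarCurvature x ∧
        (g t).weylNormSq x + 2 * (g t).tracelessRicciNormSq x ≤
          K * (g t).scalarCurvature x ^ (2 - τ))
    (L : ℝ) : ∃ t₁ ∈ Ico 0 T, ∀ t ∈ Ico t₁ T, ∃ x : M, L < (g t).scalarCurvatureWith (cov t) x := by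
  have hflow := hmax.isRicciFlow
  have hRiem := hmax.isRiemannian
  set A := K * m ^ (-τ) + 1 / 6 with hA
  set L' := max L 0 + 1 with hL'
  have hL'0 : 0 ≤ L' := by rw [hL']; positivity
  have hLL' : L < L' := by rw [hL']; linarith [le_max_left L 0]
  obtain ⟨t₁, ht₁, hviol⟩ := ricciFlow_curvature_blowup_of_shortTime
    ricciFlow_shortTime_existence_holds (𝓡 4) M T g cov hmax (Real.sqrt (A * L' ^ 2))
  refine ⟨t₁, ht₁, fun t ht ↦ ?_⟩
  have ht' : t ∈ Ico 0 T := ⟨ht₁.1.trans ht.1, ht.2⟩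
  obtain ⟨x, hx⟩ : ∃ x : M, A * L' ^ 2 < (g t).curvNormSqWith (cov t) x := by
    by_contra hcon
    push Not at hcon
    exact hviol t ht (curvatureBoundedBy_of_curvNormSqWith_le (hRiem t ht')
      (hflow.isLeviCivita t ht') hcon)
  refine ⟨x, ?_⟩
  obtain ⟨hmR, -, -, hp⟩ := roundness_dictionary hflow hRiem hpinch ht' x
  set R := (g t).scalarCurvatureWith (cov t) x with hRdef
  have hR0 : 0 < R := hm.trans_le hmR
  have hrpow : R ^ (2 - τ) ≤ m ^ (-τ) * R ^ 2 := by
    rw [Real.rpow_sub hR0, Real.rpow_two, div_eq_mul_inv, ← Real.rpow_neg hR0.le, mul_comm]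
    exact mul_le_mul_of_nonneg_right (Real.rpow_le_rpow_of_nonpos hm hmR (by linarith))
      (sq_nonneg _)
  have hKr : K * R ^ (2 - τ) ≤ K * (m ^ (-τ) * R ^ 2) := mul_le_mul_of_nonneg_left hrpow hK.le
  have hsq : L' ^ 2 < R ^ 2 := by
    by_contra hcon
    push Not at hcon
    have := mul_le_mul_of_nonneg_left hcon (by rw [hA]; positivity : 0 ≤ A)
    rw [hA] at this hx; linarith
  exact hLL'.trans (lt_of_pow_lt_pow_left₀ 2 hR0.le hsq)

/-- **HELPER — THE TYPE-I SANDWICH `1 ≤ (T−t)R ≤ 3` AT LATE TIMES** (Hamilton 1982, §16,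
Lemmas 16.1–16.5 in unnormalised clothes; registered helper of stub `stub_roundnessRate`). For a
maximal Ricci flow on a closed 4-manifold with the invariant pinching and the ratio property
`R ≥ θ R_max` at late times for every `θ < 1`, there is `t₀ ∈ [0, T)` such that for `t ∈ [t₀, T)`:
(i) `1 ≤ (T−t)R ≤ 3` and `K R^{−τ} ≤ 1/20` everywhere; (ii) if `2|Ric|² ≤ aR²` on `M × [t, T)`,
`a > 0`, some point has `a(T−t)R ≥ 1` (maximum principle + `R_max → ∞`); (iii) some point has
`(T−t)R ≤ 2` (Cor. 3.2.4 restarted at `t`). For (i) take `θ = 9/10`: `R_min → ∞` makes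
`K R^{−τ} ≤ 1/20`, so `2|Ric|² = 2|E|² + R²/2 ≤ (11/20)R²`, (ii) gives `R_max(T−t) ≥ 20/11`,
`(T−t)R ≥ θ·20/11 ≥ 1`, and (iii) gives `(T−t)R ≤ (T−t)R_min/θ ≤ 20/9 ≤ 3`.
[cite: Hamilton1982, §16, Lemmas 16.1–16.5] [cite: Topping2006, Thm. 3.1.1 and Cor. 3.2.4] -/
theorem helper_roundnessTypeOne :
    ∀ (M : Type) [TopologicalSpace M] [T2Space M] [SecondCountableTopology M]
      [ChartedSpace (EuclideanSpace ℝ (Fin 4)) M] [IsManifold (𝓡 4) ∞ M] [CompactSpace M]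
      [Nonempty M]
      (g : ℝ → PseudoRiemannianMetric (𝓡 4) ∞ (EuclideanSpace ℝ (Fin 4)) (TangentSpace (𝓡 4) : M → Type _))
      (cov : ℝ → CovariantDerivative (𝓡 4) (EuclideanSpace ℝ (Fin 4)) (TangentSpace (𝓡 4) : M → Type _))
      (T m K τ : ℝ), 0 < m → 0 < K → 0 < τ →
      IsMaximalRicciFlow g cov T →
      (∀ t ∈ Ico 0 T, ∀ [(g t).HasLeviCivita] (x : M),
        m ≤ (g t).scalarCurvature x ∧
          (g t).weylNormSq x + 2 * (g t).tracelessRicciNormSq x ≤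
            K * (g t).scalarCurvature x ^ (2 - τ)) →
      (∀ θ : ℝ, 0 < θ → θ < 1 → ∃ t₀ ∈ Ico 0 T, ∀ t ∈ Ico t₀ T, ∀ x y : M,
        θ * (g t).scalarCurvatureWith (cov t) y ≤ (g t).scalarCurvatureWith (cov t) x) →
      ∃ t₀ ∈ Ico 0 T, ∀ t ∈ Ico t₀ T,
        (∀ x : M, 1 ≤ (T - t) * (g t).scalarCurvatureWith (cov t) x ∧
          (T - t) * (g t).scalarCurvatureWith (cov t) x ≤ 3 ∧
          K * (g t).scalarCurvatureWith (cov t) x ^ (-τ) ≤ 1 / 20) ∧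
        (∀ a : ℝ, 0 < a →
          (∀ s ∈ Ico t T, ∀ x : M,
            2 * (g s).normSq x ((cov s).ricci x) ≤ a * (g s).scalarCurvatureWith (cov s) x ^ 2) →
          ∃ x : M, 1 ≤ a * (T - t) * (g t).scalarCurvatureWith (cov t) x) ∧
        (∃ x : M, (T - t) * (g t).scalarCurvatureWith (cov t) x ≤ 2) := by
  intro M _ _ _ _ _ _ _ g cov T m K τ hm hK hτ0 hmax hpinch hratio
  have hflow := hmax.isRicciFlow
  have hRiem := hmax.isRiemannian
  have hn4 : (Module.finrank ℝ (EuclideanSpace ℝ (Fin 4)) : ℝ) / 2 = 2 := by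
    rw [finrank_euclideanSpace_fin]; norm_num
  -- (iii) at every time
  have hmin : ∀ t ∈ Ico 0 T, ∃ x : M, (T - t) * (g t).scalarCurvatureWith (cov t) x ≤ 2 := by
    intro t ht
    obtain ⟨x, hx⟩ := exists_mul_scalarCurvatureWith_le hflow hRiem ht
    exact ⟨x, hx.trans_eq hn4⟩
  -- (ii) at every time: `R` is unbounded on every `[t, T)`
  have hunb : ∀ t ∈ Ico 0 T, ∀ L : ℝ, ∃ s ∈ Ico t T, ∃ x : M,
      L < (g s).scalarCurvatureWith (cov s) x := by
    intro t ht L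
    obtain ⟨t₁, ht₁, h⟩ := roundness_scalarCurvature_unbounded hmax hm hK hτ0 hpinch L
    exact ⟨max t t₁, ⟨le_max_left _ _, max_lt ht.2 ht₁.2⟩,
      h _ ⟨le_max_right _ _, max_lt ht.2 ht₁.2⟩⟩
  have hlow : ∀ t ∈ Ico 0 T, ∀ a : ℝ, 0 < a →
      (∀ s ∈ Ico t T, ∀ x : M,
        2 * (g s).normSq x ((cov s).ricci x) ≤ a * (g s).scalarCurvatureWith (cov s) x ^ 2) →
      ∃ x : M, 1 ≤ a * (T - t) * (g t).scalarCurvatureWith (cov t) x :=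
    fun t ht a ha h ↦ exists_le_mul_scalarCurvatureWith hflow hRiem ht ha h (hunb t ht)
  -- (i): the ratio at `θ = 9/10` beyond the level `R_* = (20K)^{1/τ}`
  obtain ⟨tθ, htθ, hθ⟩ := hratio (9 / 10) (by norm_num) (by norm_num)
  set Rs : ℝ := (20 * K) ^ (1 / τ) with hRs
  have h20K : 0 < 20 * K := by positivity
  have hRs0 : 0 < Rs := Real.rpow_pos_of_pos h20K _
  have hRsτ : Rs ^ (-τ) = (20 * K)⁻¹ := by
    rw [hRs, ← Real.rpow_mul h20K.le, show 1 / τ * -τ = -1 by field_simp, Real.rpow_neg_one]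
  obtain ⟨tL, htL, hL⟩ :=
    roundness_scalarCurvature_unbounded hmax hm hK hτ0 hpinch (Rs / (9 / 10))
  set t₀ := max tθ tL with ht₀
  have ht₀T : t₀ < T := max_lt htθ.2 htL.2
  have ht₀0 : 0 ≤ t₀ := le_max_of_le_left htθ.1
  -- `K R^{-τ} ≤ 1/20` on `[t₀, T)`
  have hsmall : ∀ s ∈ Ico t₀ T, ∀ x : M,
      m ≤ (g s).scalarCurvatureWith (cov s) x ∧
        K * (g s).scalarCurvatureWith (cov s) x ^ (-τ) ≤ 1 / 20 := by
    intro s hs x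
    have hs' : s ∈ Ico 0 T := ⟨ht₀0.trans hs.1, hs.2⟩
    obtain ⟨y, hy⟩ := hL s ⟨(le_max_right _ _).trans hs.1, hs.2⟩
    have hxy := hθ s ⟨(le_max_left _ _).trans hs.1, hs.2⟩ x y
    have hRx : Rs ≤ (g s).scalarCurvatureWith (cov s) x := by
      have : (9 / 10 : ℝ) * (Rs / (9 / 10)) = Rs := by ring
      nlinarith
    obtain ⟨hmR, -, -, -⟩ := roundness_dictionary hflow hRiem hpinch hs' x
    refine ⟨hmR, ?_⟩
    have h1 : (g s).scalarCurvatureWith (cov s) x ^ (-τ) ≤ Rs ^ (-τ) :=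
      Real.rpow_le_rpow_of_nonpos hRs0 hRx (by linarith)
    rw [hRsτ] at h1
    calc K * (g s).scalarCurvatureWith (cov s) x ^ (-τ) ≤ K * (20 * K)⁻¹ :=
          mul_le_mul_of_nonneg_left h1 hK.le
      _ = 1 / 20 := by field_simp
  refine ⟨t₀, ⟨ht₀0, ht₀T⟩, fun t ht ↦ ?_⟩
  have ht' : t ∈ Ico 0 T := ⟨ht₀0.trans ht.1, ht.2⟩
  have hTt : 0 < T - t := sub_pos.2 ht.2
  refine ⟨fun x ↦ ?_, hlow t ht', hmin t ht'⟩
  -- `2|Ric|² ≤ (11/20) R²` on `[t, T)`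
  have hRic : ∀ s ∈ Ico t T, ∀ y : M, 2 * (g s).normSq y ((cov s).ricci y) ≤
      11 / 20 * (g s).scalarCurvatureWith (cov s) y ^ 2 := by
    intro s hs y
    have hs' : s ∈ Ico 0 T := ⟨ht'.1.trans hs.1, hs.2⟩
    obtain ⟨hmR, -, hWnn, hp⟩ := roundness_dictionary hflow hRiem hpinch hs' y
    obtain ⟨-, hKs⟩ := hsmall s ⟨ht.1.trans hs.1, hs.2⟩ y
    set R := (g s).scalarCurvatureWith (cov s) y with hR
    have hR0 : 0 < R := hm.trans_le hmR
    have hsplit : K * R ^ (2 - τ) = K * R ^ (-τ) * R ^ 2 := by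
      rw [sub_eq_add_neg, Real.rpow_add hR0, Real.rpow_two]; ring
    have hKR : K * R ^ (2 - τ) ≤ 1 / 20 * R ^ 2 := by
      rw [hsplit]; exact mul_le_mul_of_nonneg_right hKs (sq_nonneg _)
    linarith
  obtain ⟨x₂, hx₂⟩ := hlow t ht' (11 / 20) (by norm_num) hRic
  obtain ⟨x₁, hx₁⟩ := hmin t ht'
  have htθ' : t ∈ Ico tθ T := ⟨(le_max_left _ _).trans ht.1, ht.2⟩
  have h₂ := mul_le_mul_of_nonneg_left (hθ t htθ' x x₂) hTt.le
  have h₁ := mul_le_mul_of_nonneg_left (hθ t htθ' x₁ x) hTt.le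
  exact ⟨by nlinarith, by nlinarith, (hsmall t ht x).2⟩

end FourDim

end Summit.SmoothPoincare4.SmoothPoincare4.Theorems.MargerinRails

end
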